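import Literature.MathematicalPhysics.QuantumFieldTheory.ConformalBootstrap3D.BlockZSeriesAB
import Mathlib.Analysis.Analytic.Binomial
import Mathlib.Analysis.SpecialFunctions.Pow.Deriv
import Mathlib.Analysis.Normed.Ring.InfiniteSum
import Mathlib.Topology.Algebra.InfiniteSum.Constructions
import Mathlib.Topology.Algebra.InfiniteSum.Real
import HarnessLib

/-!
# The Dolan–Osborn conjugation symmetry `(Δ₁₂, Δ₃₄) → (-Δ₁₂, -Δ₃₄)` of the typed 3D blocks

Dolan–Osborn 2011 §2: the single-variable operator `D_x(a,b) = x²(1-x)∂² - (a+b+1)x²∂ - ab x` satisfies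
`D_x(a,b) = (1-x)^{-a-b} D_x(-a,-b) (1-x)^{a+b}` (their eq. (2.38), label `\idD`), whence for the two-variable
Casimir operator `Δ^{(ε)}(a,b) = v^{-a-b} Δ^{(ε)}(-a,-b) v^{a+b}`, `v = (1-x)(1-x̄)` (their (2.43), `\Dveq`), which
"implies" the conjugation symmetry of conformal partial waves (their (2.44), `\gveq`):

  `F_{λ₁λ₂}(a,b;x,x̄) = v^{-(a+b)} F_{λ₁λ₂}(-a,-b;x,x̄)`.

(The arXiv v2 source PRINTS the exponent in (2.44) as `+(a+b)`; the sign is fixed by (2.37) — Euler's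
transformation `g_p(a,b;x) = (1-x)^{-a-b} g_p(-a,-b;x)` of the collinear block — by (2.38)/(2.43), and by the
four-point prefactor of their (2.12); pub-ising3d AXIOMS-SOURCES S10.1 records a 30-digit check with the `d = 3`
recursion. Equation numbers are by `\eqn` count of the arXiv v2 source; the TeX labels are unambiguous.)

In the tree's conventions (`SigmaEpsilonSystem`: `a = -Δ₁₂/2`, `b = Δ₃₄/2`, so `a + b = (Δ₃₄ - Δ₁₂)/2`) this file
PROVES the symmetry for the typed block predicate:

* `dolanOsbornD_conj` — the operator identity (2.38) on real functions: for `x < 1` and `f` twice differentiable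
  near `x`, `D_x(-a,-b)[(1-·)^{a+b} f](x) = (1-x)^{a+b} D_x(a,b)[f](x)`.
* `IsDoublePowerSeriesOn.conj` — the series clause is stable: if `K` is an absolutely convergent double power
  series on the unit bidisk then so is `(1-z)^α (1-z̄)^α K(z,z̄)`, with coefficients the double Cauchy product with
  the binomial coefficients of `(1-x)^α = Σ_i (-1)^i C(α,i) x^i` (Mathlib's `binomialSeries`,
  `Real.one_add_rpow_hasFPowerSeriesOnBall_zero`).
* `IsConformalBlock3DAbove.conj`, `IsConformalBlock3D.conj` — **if `g` is the block `g^{Δ₁₂,Δ₃₄}_{Δ,ℓ}` then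
  `((1-z)(1-z̄))^{(Δ₃₄-Δ₁₂)/2} · g` is the block `g^{-Δ₁₂,-Δ₃₄}_{Δ,ℓ}`** (same `Δ, ℓ`; generic predicate and the
  full predicate incl. the limit clause at non-regular points).
* `IsConformalBlock3D.eq_conj_of_neg` — uniqueness form at regular points: any typed `g^{-Δ₁₂,-Δ₃₄}` EQUALS
  `v^{(Δ₃₄-Δ₁₂)/2} g^{Δ₁₂,Δ₃₄}` on the square.
* For the `σ–ε` system: `SigmaEpsilonData.isConformalBlock3D_conj_gpm` — under A2 the function
  `v^{Δ_σε} · gpm j` is the genuine `⟨σεεσ⟩`-ordering block `g^{Δ_σε,-Δ_σε}` of the same odd operator, hence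
  (`hasSum_hrZTermAB_conj_gpm`) at every real point of the square it is the NON-NEGATIVE double series
  `Σ (A_{n,j}(-c,-c)/λ_ℓ) 𝒫_{Δ+n,j}`, `c = Δ_σε/2` — the second reference series of the rule-3 (`⟨σεσε⟩`) analysis
  (pub-ising3d AXIOMS-SOURCES §8 R8/R8′, §10 R10), obtained from the typed `gpm` data alone.

References: F. A. Dolan, H. Osborn, *Conformal partial waves: further mathematical results*, arXiv:1108.6194, §2
eqs. (2.37)–(2.38), (2.43)–(2.44) [cite: DolanOsborn2011, §2 eqs. (2.38), (2.43)–(2.44)]; F. A. Dolan, H. Osborn,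
Nucl. Phys. B 678 (2004) 491, §3 eq. (3.11) (coefficient-level form, tree `hrCoeffAB_mul_doPochFactor`)
[cite: DolanOsborn2004, §3 eq. (3.11)].
-/

namespace Literature.MathematicalPhysics.QuantumFieldTheory.ConformalBootstrap3D

open Set Filter Topology Finset

/-! ### Part D — the operator identity `D_x(-a,-b) ∘ (1-x)^{a+b} = (1-x)^{a+b} ∘ D_x(a,b)` -/

/-- `deriv` and `deriv ∘ deriv` of a function with prescribed first derivatives near `x` and second
derivative at `x`. [folklore] -/
theorem deriv_deriv_eq_of_hasDerivAt_near {f df : ℝ → ℝ} {x f₂ : ℝ}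
    (h₁ : ∀ᶠ t in 𝓝 x, HasDerivAt f (df t) t) (h₂ : HasDerivAt df f₂ x) :
    deriv f x = df x ∧ deriv (deriv f) x = f₂ := by
  refine ⟨h₁.self_of_nhds.deriv, ?_⟩
  have he : deriv f =ᶠ[𝓝 x] df := h₁.mono fun t ht => ht.deriv
  rw [he.deriv_eq, h₂.deriv]

/-- Derivative of `t ↦ (1-t)^α` for `t < 1`: `-α (1-t)^{α-1}`. [folklore] -/
theorem hasDerivAt_one_sub_rpow (α : ℝ) {t : ℝ} (ht : t < 1) :
    HasDerivAt (fun s : ℝ => (1 - s) ^ α) (-α * (1 - t) ^ (α - 1)) t := by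
  have h1 : HasDerivAt (fun s : ℝ => 1 - s) (-1) t := by
    simpa using (hasDerivAt_id t).const_sub (1 : ℝ)
  have h2 := h1.rpow_const (p := α) (Or.inl (by linarith))
  convert h2 using 1
  ring

/-- **Dolan–Osborn 2011 eq. (2.38)** (`\idD`) as an identity of real differential expressions: for `x < 1` and
`f` with first derivatives `df` near `x` and second derivative `f₂` at `x`,
`D_x(-a,-b)[t ↦ (1-t)^{a+b} f(t)](x) = (1-x)^{a+b} · D_x(a,b)[f](x)`.
[cite: DolanOsborn2011, §2 eq. (2.38)] -/
theorem dolanOsbornD_conj (a b : ℝ) {f df : ℝ → ℝ} {x f₂ : ℝ} (hx : x < 1)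
    (h₁ : ∀ᶠ t in 𝓝 x, HasDerivAt f (df t) t) (h₂ : HasDerivAt df f₂ x) :
    dolanOsbornD (-a) (-b) (fun t => (1 - t) ^ (a + b) * f t) x =
      (1 - x) ^ (a + b) * dolanOsbornD a b f x := by
  set α := a + b with hα
  -- first derivatives of the conjugated function near `x`
  have hlt : ∀ᶠ t in 𝓝 x, t < 1 := Iio_mem_nhds hx
  have hD1 : ∀ᶠ t in 𝓝 x, HasDerivAt (fun s => (1 - s) ^ α * f s)
      (-α * (1 - t) ^ (α - 1) * f t + (1 - t) ^ α * df t) t := by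
    filter_upwards [hlt, h₁] with t ht hft
    exact (hasDerivAt_one_sub_rpow α ht).mul hft
  -- second derivative at `x`
  have hP1 : HasDerivAt (fun t => -α * (1 - t) ^ (α - 1)) (-α * (-(α - 1) * (1 - x) ^ (α - 1 - 1))) x :=
    (hasDerivAt_one_sub_rpow (α - 1) hx).const_mul (-α)
  have hD2 : HasDerivAt (fun t => -α * (1 - t) ^ (α - 1) * f t + (1 - t) ^ α * df t)
      ((-α * (-(α - 1) * (1 - x) ^ (α - 1 - 1))) * f x + (-α * (1 - x) ^ (α - 1)) * df x
        + ((-α * (1 - x) ^ (α - 1)) * df x + (1 - x) ^ α * f₂)) x :=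
    (hP1.mul h₁.self_of_nhds).add ((hasDerivAt_one_sub_rpow α hx).mul h₂)
  obtain ⟨e1, e2⟩ := deriv_deriv_eq_of_hasDerivAt_near hD1 hD2
  obtain ⟨f1, f2⟩ := deriv_deriv_eq_of_hasDerivAt_near h₁ h₂
  unfold dolanOsbornD
  rw [e1, e2, f1, f2]
  -- reduce the shifted powers to `(1-x)^α`
  have hw : (1 : ℝ) - x ≠ 0 := by linarith
  have r1 : (1 - x) ^ (α - 1) = (1 - x) ^ α / (1 - x) := Real.rpow_sub_one hw α
  have r2 : (1 - x) ^ (α - 1 - 1) = (1 - x) ^ α / (1 - x) / (1 - x) := by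
    rw [Real.rpow_sub_one hw (α - 1), r1]
  rw [r1, r2]
  field_simp
  ring

/-! ### Part A — the binomial series of `(1-x)^α` as a real power series on `(-1, 1)` -/

/-- The Taylor coefficients of `(1-x)^α`: `(-1)^i C(α, i)` (`Ring.choose`). [folklore] -/
noncomputable def oneSubRpowCoeff (α : ℝ) (i : ℕ) : ℝ :=
  (-1) ^ i * Ring.choose α i

/-- `C(α, 0)`-term: the zeroth coefficient is `1`. [folklore] -/
@[simp] theorem oneSubRpowCoeff_zero (α : ℝ) : oneSubRpowCoeff α 0 = 1 := by
  simp [oneSubRpowCoeff]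

/-- **Binomial series**: `Σ_i (-1)^i C(α,i) x^i = (1-x)^α` for `|x| < 1` (Mathlib's
`Real.one_add_rpow_hasFPowerSeriesOnBall_zero` at `-x`). [folklore] -/
theorem hasSum_oneSubRpowCoeff (α : ℝ) {x : ℝ} (hx : |x| < 1) :
    HasSum (fun i => oneSubRpowCoeff α i * x ^ i) ((1 - x) ^ α) := by
  have hmem : -x ∈ Metric.eball (0 : ℝ) 1 := by
    rw [← ENNReal.ofReal_one, Metric.eball_ofReal, Metric.mem_ball, dist_zero_right, norm_neg,
      Real.norm_eq_abs]
    exact hx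
  have h := (Real.one_add_rpow_hasFPowerSeriesOnBall_zero (a := α)).hasSum hmem
  have ht : (fun n => binomialSeries ℝ α n fun _ => -x) = fun n => oneSubRpowCoeff α n * x ^ n := by
    funext n
    rw [binomialSeries, FormalMultilinearSeries.ofScalars_apply_eq, smul_eq_mul, oneSubRpowCoeff, neg_pow]
    ring
  rw [ht, zero_add, ← sub_eq_add_neg] at h
  exact h

/-- Absolute convergence of the binomial series at every radius `r < 1` (comparison with a geometric series
at the radius `(1+r)/2`). [folklore] -/
theorem summable_abs_oneSubRpowCoeff (α : ℝ) {r : ℝ} (hr0 : 0 ≤ r) (hr1 : r < 1) :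
    Summable (fun i => |oneSubRpowCoeff α i| * r ^ i) := by
  set r' := (1 + r) / 2 with hr'
  have hr'0 : 0 < r' := by rw [hr']; linarith
  have hr'1 : r' < 1 := by rw [hr']; linarith
  have hrr' : r < r' := by rw [hr']; linarith
  have hs : Summable (fun i => oneSubRpowCoeff α i * r' ^ i) :=
    (hasSum_oneSubRpowCoeff α (x := r') (by rw [abs_of_nonneg hr'0.le]; exact hr'1)).summable
  have ht : Tendsto (fun i => ‖oneSubRpowCoeff α i * r' ^ i‖) atTop (𝓝 0) := by
    simpa using hs.tendsto_atTop_zero.norm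
  obtain ⟨C, hC⟩ := ht.bddAbove_range
  have hC' : ∀ i, |oneSubRpowCoeff α i| * r' ^ i ≤ C := fun i => by
    have h : ‖oneSubRpowCoeff α i * r' ^ i‖ ≤ C := hC ⟨i, rfl⟩
    rwa [Real.norm_eq_abs, abs_mul, abs_of_nonneg (pow_nonneg hr'0.le _)] at h
  have hC0 : 0 ≤ C := le_trans (by positivity) (hC' 0)
  set ρ := r / r' with hρ
  have hρ0 : 0 ≤ ρ := div_nonneg hr0 hr'0.le
  have hρ1 : ρ < 1 := (div_lt_one hr'0).mpr hrr'
  refine Summable.of_nonneg_of_le (fun i => by positivity) (fun i => ?_)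
    ((summable_geometric_of_lt_one hρ0 hρ1).mul_left C)
  have hri : r ^ i = r' ^ i * ρ ^ i := by
    rw [← mul_pow, hρ, mul_div_cancel₀ _ hr'0.ne']
  rw [hri, ← mul_assoc]
  exact mul_le_mul_of_nonneg_right (hC' i) (pow_nonneg hρ0 _)

/-! ### Part B — the double power series of `(1-z)^α (1-z̄)^α K(z, z̄)` -/

/-- The coefficients of `(1-z)^α (1-z̄)^α K(z,z̄)`: the double Cauchy product
`k'_{mn} = Σ_{i ≤ m} Σ_{j ≤ n} c_i c_j k_{m-i,n-j}` with `c_i = (-1)^i C(α,i)`. [folklore] -/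
noncomputable def conjCoeff (α : ℝ) (k : ℕ × ℕ → ℝ) (q : ℕ × ℕ) : ℝ :=
  ∑ i ∈ range (q.1 + 1), ∑ j ∈ range (q.2 + 1),
    oneSubRpowCoeff α i * oneSubRpowCoeff α j * k (q.1 - i, q.2 - j)

section Series

variable {k : ℕ × ℕ → ℝ} {K : ℝ → ℝ → ℝ}

/-- The regrouping map `((i,j),(p₁,p₂)) ↦ ((i+p₁, j+p₂), (i,j))`. [folklore] -/
def conjShift (x : (ℕ × ℕ) × (ℕ × ℕ)) : (ℕ × ℕ) × (ℕ × ℕ) :=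
  ((x.1.1 + x.2.1, x.1.2 + x.2.2), x.1)

/-- `conjShift` is injective. [folklore] -/
theorem conjShift_injective : Function.Injective conjShift := by
  rintro ⟨⟨i, j⟩, ⟨p₁, p₂⟩⟩ ⟨⟨i', j'⟩, ⟨p₁', p₂'⟩⟩ hxy
  simp only [conjShift, Prod.mk.injEq] at hxy
  obtain ⟨⟨h1, h2⟩, h3, h4⟩ := hxy
  subst h3 h4
  have hp₁ : p₁ = p₁' := by omega
  have hp₂ : p₂ = p₂' := by omega
  subst hp₁ hp₂
  rfl

/-- The regrouped family: at `(q, (i,j))` with `i ≤ q₁`, `j ≤ q₂` the term `c_i c_j k_{q-(i,j)} z^{q₁} z̄^{q₂}`,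
zero elsewhere. [folklore] -/
noncomputable def conjFamily (c : ℕ → ℝ) (k : ℕ × ℕ → ℝ) (z zb : ℝ) (y : (ℕ × ℕ) × (ℕ × ℕ)) : ℝ :=
  if y.2.1 ≤ y.1.1 ∧ y.2.2 ≤ y.1.2 then
    c y.2.1 * c y.2.2 * k (y.1.1 - y.2.1, y.1.2 - y.2.2) * z ^ y.1.1 * zb ^ y.1.2
  else 0

/-- Pulling the regrouped family back along `conjShift` gives the plain product family. [folklore] -/
theorem conjFamily_conjShift (c : ℕ → ℝ) (k : ℕ × ℕ → ℝ) (z zb : ℝ) (x : (ℕ × ℕ) × (ℕ × ℕ)) :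
    conjFamily c k z zb (conjShift x) =
      (c x.1.1 * z ^ x.1.1) * (c x.1.2 * zb ^ x.1.2) * (k x.2 * z ^ x.2.1 * zb ^ x.2.2) := by
  obtain ⟨⟨i, j⟩, ⟨p₁, p₂⟩⟩ := x
  simp only [conjFamily, conjShift]
  rw [if_pos ⟨Nat.le_add_right _ _, Nat.le_add_right _ _⟩, Nat.add_sub_cancel_left,
    Nat.add_sub_cancel_left, pow_add, pow_add]
  ring

/-- Off the range of `conjShift` the regrouped family vanishes. [folklore] -/
theorem conjFamily_eq_zero_of_not_mem_range (c : ℕ → ℝ) (k : ℕ × ℕ → ℝ) (z zb : ℝ)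
    {y : (ℕ × ℕ) × (ℕ × ℕ)} (hy : y ∉ Set.range conjShift) : conjFamily c k z zb y = 0 := by
  obtain ⟨⟨q₁, q₂⟩, ⟨i, j⟩⟩ := y
  simp only [conjFamily]
  split_ifs with hcond
  · exfalso
    apply hy
    refine ⟨((i, j), (q₁ - i, q₂ - j)), ?_⟩
    show ((i + (q₁ - i), j + (q₂ - j)), (i, j)) = ((q₁, q₂), (i, j))
    rw [Nat.add_sub_of_le hcond.1, Nat.add_sub_of_le hcond.2]
  · rfl

/-- The fibre of the regrouped family over `q` is supported in the box `[0,q₁] × [0,q₂]`. [folklore] -/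
theorem conjFamily_eq_zero_of_not_mem_box (c : ℕ → ℝ) (k : ℕ × ℕ → ℝ) (z zb : ℝ) (q : ℕ × ℕ)
    {ij : ℕ × ℕ} (hij : ij ∉ range (q.1 + 1) ×ˢ range (q.2 + 1)) : conjFamily c k z zb (q, ij) = 0 := by
  obtain ⟨q₁, q₂⟩ := q
  obtain ⟨i, j⟩ := ij
  simp only [conjFamily]
  rw [if_neg]
  intro hcond
  apply hij
  rw [Finset.mem_product, Finset.mem_range, Finset.mem_range]
  exact ⟨by omega, by omega⟩

/-- The fibre sum over `q` is `k'_q z^{q₁} z̄^{q₂}` with `k' = conjCoeff`. [folklore] -/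
theorem sum_box_conjFamily (α : ℝ) (k : ℕ × ℕ → ℝ) (z zb : ℝ) (q : ℕ × ℕ) :
    ∑ ij ∈ range (q.1 + 1) ×ˢ range (q.2 + 1), conjFamily (oneSubRpowCoeff α) k z zb (q, ij) =
      conjCoeff α k q * z ^ q.1 * zb ^ q.2 := by
  obtain ⟨q₁, q₂⟩ := q
  rw [conjCoeff, Finset.sum_mul, Finset.sum_mul, Finset.sum_product]
  refine Finset.sum_congr rfl fun i hi => ?_
  rw [Finset.sum_mul, Finset.sum_mul]
  refine Finset.sum_congr rfl fun j hj => ?_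
  rw [Finset.mem_range] at hi hj
  simp only [conjFamily]
  rw [if_pos ⟨by omega, by omega⟩]

/-- `HasSum` over the fibre. [folklore] -/
theorem hasSum_fiber_conjFamily (α : ℝ) (k : ℕ × ℕ → ℝ) (z zb : ℝ) (q : ℕ × ℕ) :
    HasSum (fun ij => conjFamily (oneSubRpowCoeff α) k z zb (q, ij))
      (conjCoeff α k q * z ^ q.1 * zb ^ q.2) := by
  rw [← sum_box_conjFamily]
  exact hasSum_sum_of_ne_finset_zero fun ij hij => conjFamily_eq_zero_of_not_mem_box _ k z zb q hij

/-- `HasSum` of the absolute values over the fibre. [folklore] -/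
theorem hasSum_fiber_abs_conjFamily (c : ℕ → ℝ) (k : ℕ × ℕ → ℝ) (z zb : ℝ) (q : ℕ × ℕ) :
    HasSum (fun ij => ‖conjFamily c k z zb (q, ij)‖)
      (∑ ij ∈ range (q.1 + 1) ×ˢ range (q.2 + 1), ‖conjFamily c k z zb (q, ij)‖) :=
  hasSum_sum_of_ne_finset_zero fun ij hij => by
    rw [conjFamily_eq_zero_of_not_mem_box c k z zb q hij, norm_zero]

/-- The coefficient bound `|k'_q| |z|^{q₁} |z̄|^{q₂} ≤ Σ_{box} |conjFamily (q, ·)|`. [folklore] -/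
theorem abs_conjCoeff_mul_le (α : ℝ) (k : ℕ × ℕ → ℝ) (z zb : ℝ) (q : ℕ × ℕ) :
    |conjCoeff α k q| * |z| ^ q.1 * |zb| ^ q.2 ≤
      ∑ ij ∈ range (q.1 + 1) ×ˢ range (q.2 + 1), ‖conjFamily (oneSubRpowCoeff α) k z zb (q, ij)‖ := by
  calc |conjCoeff α k q| * |z| ^ q.1 * |zb| ^ q.2
      = |conjCoeff α k q * z ^ q.1 * zb ^ q.2| := by rw [abs_mul, abs_mul, abs_pow, abs_pow]
    _ = |∑ ij ∈ range (q.1 + 1) ×ˢ range (q.2 + 1), conjFamily (oneSubRpowCoeff α) k z zb (q, ij)| := by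
        rw [sum_box_conjFamily]
    _ ≤ ∑ ij ∈ range (q.1 + 1) ×ˢ range (q.2 + 1), |conjFamily (oneSubRpowCoeff α) k z zb (q, ij)| :=
        Finset.abs_sum_le_sum_abs _ _
    _ = _ := rfl

/-- **Stability of the series clause.** If `K` is an absolutely convergent double power series on the unit
bidisk with coefficients `k`, then so is `(1-z)^α (1-z̄)^α K(z, z̄)`, with coefficients `conjCoeff α k`
(product of three absolutely convergent series, regrouped along `conjShift`). [folklore] -/
theorem IsDoublePowerSeriesOn.conj (hS : IsDoublePowerSeriesOn k K) (α : ℝ) :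
    IsDoublePowerSeriesOn (conjCoeff α k) (fun z zb => (1 - z) ^ α * (1 - zb) ^ α * K z zb) := by
  intro z zb hz hzb
  -- the three absolutely convergent factors
  have hcz : HasSum (fun i => oneSubRpowCoeff α i * z ^ i) ((1 - z) ^ α) := hasSum_oneSubRpowCoeff α hz
  have hczb : HasSum (fun j => oneSubRpowCoeff α j * zb ^ j) ((1 - zb) ^ α) :=
    hasSum_oneSubRpowCoeff α hzb
  have ncz : Summable (fun i => ‖oneSubRpowCoeff α i * z ^ i‖) := by
    refine (summable_abs_oneSubRpowCoeff α (abs_nonneg z) hz).congr fun i => ?_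
    rw [Real.norm_eq_abs, abs_mul, abs_pow]
  have nczb : Summable (fun j => ‖oneSubRpowCoeff α j * zb ^ j‖) := by
    refine (summable_abs_oneSubRpowCoeff α (abs_nonneg zb) hzb).congr fun j => ?_
    rw [Real.norm_eq_abs, abs_mul, abs_pow]
  obtain ⟨hKabs, hKeq⟩ := hS z zb hz hzb
  have nK : Summable (fun p : ℕ × ℕ => ‖k p * z ^ p.1 * zb ^ p.2‖) := by
    refine hKabs.congr fun p => ?_
    rw [Real.norm_eq_abs, abs_mul, abs_mul, abs_pow, abs_pow]
  have hK : HasSum (fun p : ℕ × ℕ => k p * z ^ p.1 * zb ^ p.2) (K z zb) := by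
    rw [hKeq]; exact nK.of_norm.hasSum
  -- the product family on `(ℕ × ℕ) × (ℕ × ℕ)` and its regrouping (factors named to keep unification
  -- first-order)
  set fz : ℕ → ℝ := fun i => oneSubRpowCoeff α i * z ^ i with hfz
  set fzb : ℕ → ℝ := fun j => oneSubRpowCoeff α j * zb ^ j with hfzb
  set fK : ℕ × ℕ → ℝ := fun p => k p * z ^ p.1 * zb ^ p.2 with hfK
  set fB : ℕ × ℕ → ℝ := fun ij => fz ij.1 * fzb ij.2 with hfB
  set fT : (ℕ × ℕ) × (ℕ × ℕ) → ℝ := fun x => fB x.1 * fK x.2 with hfT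
  have nB : Summable (fun ij : ℕ × ℕ => ‖fB ij‖) := Summable.mul_norm (f := fz) (g := fzb) ncz nczb
  have hBsum : HasSum fB ((1 - z) ^ α * (1 - zb) ^ α) :=
    HasSum.mul (f := fz) (g := fzb) hcz hczb nB.of_norm
  have nT : Summable (fun x : (ℕ × ℕ) × (ℕ × ℕ) => ‖fT x‖) :=
    Summable.mul_norm (f := fB) (g := fK) nB nK
  have hTsum : HasSum fT ((1 - z) ^ α * (1 - zb) ^ α * K z zb) :=
    HasSum.mul (f := fB) (g := fK) hBsum hK nT.of_norm
  have hcomp : conjFamily (oneSubRpowCoeff α) k z zb ∘ conjShift = fT := by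
    funext x
    rw [Function.comp_apply, conjFamily_conjShift]
  have hT'sum : HasSum (conjFamily (oneSubRpowCoeff α) k z zb) ((1 - z) ^ α * (1 - zb) ^ α * K z zb) := by
    refine (conjShift_injective.hasSum_iff fun y hy =>
      conjFamily_eq_zero_of_not_mem_range _ k z zb hy).mp ?_
    rw [hcomp]
    exact hTsum
  have hcompAbs : (fun y => ‖conjFamily (oneSubRpowCoeff α) k z zb y‖) ∘ conjShift = fun x => ‖fT x‖ := by
    funext x
    rw [Function.comp_apply, conjFamily_conjShift]
  have hT'abs : HasSum (fun y => ‖conjFamily (oneSubRpowCoeff α) k z zb y‖) (∑' x, ‖fT x‖) := by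
    refine (conjShift_injective.hasSum_iff (f := fun y => ‖conjFamily (oneSubRpowCoeff α) k z zb y‖)
      fun y hy => by rw [conjFamily_eq_zero_of_not_mem_range _ k z zb hy, norm_zero]).mp ?_
    rw [hcompAbs]
    exact nT.hasSum
  -- sum fibrewise
  have hmain : HasSum (fun q : ℕ × ℕ => conjCoeff α k q * z ^ q.1 * zb ^ q.2)
      ((1 - z) ^ α * (1 - zb) ^ α * K z zb) :=
    hT'sum.prod_fiberwise (hasSum_fiber_conjFamily α k z zb)
  have habs : Summable (fun q : ℕ × ℕ =>
      ∑ ij ∈ range (q.1 + 1) ×ˢ range (q.2 + 1), ‖conjFamily (oneSubRpowCoeff α) k z zb (q, ij)‖) :=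
    (hT'abs.prod_fiberwise (hasSum_fiber_abs_conjFamily _ k z zb)).summable
  exact ⟨Summable.of_nonneg_of_le (fun q => by positivity) (abs_conjCoeff_mul_le α k z zb) habs,
    hmain.tsum_eq.symm⟩

/-- The conjugated coefficient array inherits the symmetry `k_{nm} = k_{mn}`. [folklore] -/
theorem conjCoeff_symm (α : ℝ) (hsym : ∀ p : ℕ × ℕ, k (p.2, p.1) = k p) (p : ℕ × ℕ) :
    conjCoeff α k (p.2, p.1) = conjCoeff α k p := by
  unfold conjCoeff
  rw [Finset.sum_comm]
  refine Finset.sum_congr rfl fun i _ => Finset.sum_congr rfl fun j _ => ?_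
  rw [← hsym (p.1 - i, p.2 - j)]
  ring

/-- The conjugated array keeps the Dolan–Osborn boundary row: `k'_{m0} = k_{m0}`-pattern
(`c_0 = 1`, and `k_{m0} = 0` for `m < ℓ`). [folklore] -/
theorem hasLeadingPart_conjCoeff (α : ℝ) {ℓ : ℕ} (hlead : HasLeadingPart ℓ k) :
    HasLeadingPart ℓ (conjCoeff α k) := by
  constructor
  · intro m hm
    unfold conjCoeff
    refine Finset.sum_eq_zero fun i hi => Finset.sum_eq_zero fun j _ => ?_
    have h0 : k (m - i, 0 - j) = 0 := by
      rw [Nat.zero_sub]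
      exact hlead.1 _ (by omega)
    rw [h0, mul_zero]
  · unfold conjCoeff
    rw [Finset.sum_eq_single_of_mem 0 (by simp) ?_]
    · simp [hlead.2]
    · intro i hi hi0
      refine Finset.sum_eq_zero fun j _ => ?_
      rw [Finset.mem_range] at hi
      have h0 : k (ℓ - i, 0 - j) = 0 := by
        rw [Nat.zero_sub]
        exact hlead.1 _ (by omega)
      rw [h0, mul_zero]

end Series

/-! ### Part C — the conjugated block and the Casimir equation -/

/-- The conjugated function `v^α · g`, `v = (1-z)(1-z̄)`. For `α = (Δ₃₄-Δ₁₂)/2` and `g = g^{Δ₁₂,Δ₃₄}_{Δ,ℓ}`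
this is `g^{-Δ₁₂,-Δ₃₄}_{Δ,ℓ}` (Dolan–Osborn 2011 eq. (2.44), sign as in (2.37)–(2.38)).
[cite: DolanOsborn2011, §2 eqs. (2.43)–(2.44)] -/
noncomputable def conjBlock (α : ℝ) (g : ℝ → ℝ → ℝ) (z zb : ℝ) : ℝ :=
  ((1 - z) * (1 - zb)) ^ α * g z zb

/-- Unfolding lemma. [folklore] -/
theorem conjBlock_apply (α : ℝ) (g : ℝ → ℝ → ℝ) (z zb : ℝ) :
    conjBlock α g z zb = ((1 - z) * (1 - zb)) ^ α * g z zb := rfl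

/-- On `z, z̄ < 1` the prefactor splits: `v^α = (1-z)^α (1-z̄)^α`. [folklore] -/
theorem conjBlock_eq_of_lt (α : ℝ) (g : ℝ → ℝ → ℝ) {z zb : ℝ} (hz : z < 1) (hzb : zb < 1) :
    conjBlock α g z zb = (1 - z) ^ α * (1 - zb) ^ α * g z zb := by
  unfold conjBlock
  rw [Real.mul_rpow (by linarith) (by linarith)]

/-- The conjugated function is positive-proportional to `g` on the square: `v^α > 0`. [folklore] -/
theorem conjBlock_prefactor_pos (α : ℝ) {z zb : ℝ} (hz : z < 1) (hzb : zb < 1) :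
    0 < ((1 - z) * (1 - zb)) ^ α :=
  Real.rpow_pos_of_pos (mul_pos (by linarith) (by linarith)) α

/-- Conjugating twice with opposite exponents returns `g` on the square. [folklore] -/
theorem conjBlock_neg_conjBlock (α : ℝ) (g : ℝ → ℝ → ℝ) {z zb : ℝ} (hz : z < 1) (hzb : zb < 1) :
    conjBlock (-α) (conjBlock α g) z zb = g z zb := by
  unfold conjBlock
  have hv : 0 < (1 - z) * (1 - zb) := mul_pos (by linarith) (by linarith)
  rw [← mul_assoc, ← Real.rpow_add hv, neg_add_cancel, Real.rpow_zero, one_mul]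

/-- `dolanOsbornD` commutes with constant factors (Mathlib's `deriv` of `c • f` needs no differentiability
over a field). [folklore] -/
theorem dolanOsbornD_const_mul (a b C : ℝ) (f : ℝ → ℝ) (x : ℝ) :
    dolanOsbornD a b (fun t => C * f t) x = C * dolanOsbornD a b f x := by
  unfold dolanOsbornD
  simp only [deriv_const_mul_field']
  ring

section Casimir

variable {k : ℕ × ℕ → ℝ} {K : ℝ → ℝ → ℝ}

/-- **Dolan–Osborn 2011 eq. (2.43) on the square** (`Δ^{(ε)}(a,b) = v^{-a-b} Δ^{(ε)}(-a,-b) v^{a+b}`,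
at `ε = ½`): if `g = (z z̄)^{(Δ-ℓ)/2} K` with `K` a double power series satisfies the Casimir equation with
parameters `(Δ₁₂, Δ₃₄)` on `(0,1)²`, then `v^{(Δ₃₄-Δ₁₂)/2} g` satisfies it with `(-Δ₁₂, -Δ₃₄)`. The partial
functions of `g` are generalised power series (`BlockCoefficientExtraction`), differentiated termwise; the
single-variable identity is `dolanOsbornD_conj`; the `ε`-cross term commutes with `v^α` exactly.
[cite: DolanOsborn2011, §2 eq. (2.43)] -/
theorem casimirEq3D_conjBlock {Δ₁₂ Δ₃₄ Δ : ℝ} {ℓ : ℕ} {g : ℝ → ℝ → ℝ}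
    (hS : IsDoublePowerSeriesOn k K)
    (hg : ∀ z zb : ℝ, z ∈ Ioo (0 : ℝ) 1 → zb ∈ Ioo (0 : ℝ) 1 →
      g z zb = (z * zb) ^ ((Δ - (ℓ : ℝ)) / 2) * K z zb)
    (hC : ∀ z zb : ℝ, z ∈ Ioo (0 : ℝ) 1 → zb ∈ Ioo (0 : ℝ) 1 → CasimirEq3D Δ₁₂ Δ₃₄ Δ ℓ g z zb)
    {z zb : ℝ} (hz : z ∈ Ioo (0 : ℝ) 1) (hzb : zb ∈ Ioo (0 : ℝ) 1) :
    CasimirEq3D (-Δ₁₂) (-Δ₃₄) Δ ℓ (conjBlock ((Δ₃₄ - Δ₁₂) / 2) g) z zb := by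
  obtain ⟨hz0, hz1⟩ := hz
  obtain ⟨hzb0, hzb1⟩ := hzb
  set β := (Δ - (ℓ : ℝ)) / 2 with hβ
  set a := -Δ₁₂ / 2 with ha
  set b := Δ₃₄ / 2 with hb
  set α := (Δ₃₄ - Δ₁₂) / 2 with hαdef
  have hα : α = a + b := by rw [hαdef, ha, hb]; ring
  -- the partial functions of `g` are generalised power series on `(0,1)`
  have G1 : GeomSummable (fun p : ℕ × ℕ => k p * (zb ^ β * zb ^ p.2)) Prod.fst :=
    hS.geomSummable_fst hzb0.le hzb1 _
  have G2 : GeomSummable (fun p : ℕ × ℕ => k p * (z ^ β * z ^ p.1)) Prod.snd :=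
    hS.geomSummable_snd hz0.le hz1 _
  have E1 : EqOn (fun t => g t zb)
      (gps (fun p : ℕ × ℕ => k p * (zb ^ β * zb ^ p.2)) Prod.fst β) (Ioo 0 1) := by
    intro t ht
    simp only [gps]
    rw [hg t zb ht ⟨hzb0, hzb1⟩, hS.eq_tsum ht.1.le ht.2 hzb0.le hzb1, Real.mul_rpow ht.1.le hzb0.le,
      ← tsum_mul_left]
    refine tsum_congr fun p => ?_
    rw [Real.rpow_add ht.1, Real.rpow_natCast]; ring
  have E2 : EqOn (fun t => g z t)
      (gps (fun p : ℕ × ℕ => k p * (z ^ β * z ^ p.1)) Prod.snd β) (Ioo 0 1) := by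
    intro t ht
    simp only [gps]
    rw [hg z t ⟨hz0, hz1⟩ ht, hS.eq_tsum hz0.le hz1 ht.1.le ht.2, Real.mul_rpow hz0.le ht.1.le,
      ← tsum_mul_left]
    refine tsum_congr fun p => ?_
    rw [Real.rpow_add ht.1, Real.rpow_natCast]; ring
  -- derivative data of the two partial functions near the point
  set F1 := gps (fun p : ℕ × ℕ => k p * (zb ^ β * zb ^ p.2) * (((p.1 : ℕ) : ℝ) + β)) Prod.fst (β - 1)
    with hF1
  set F2 := gps (fun p : ℕ × ℕ => k p * (zb ^ β * zb ^ p.2) * (((p.1 : ℕ) : ℝ) + β) *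
      (((p.1 : ℕ) : ℝ) + (β - 1))) Prod.fst (β - 1 - 1) with hF2
  have hd1 : ∀ᶠ t in 𝓝 z, HasDerivAt (fun s => g s zb) (F1 t) t := by
    filter_upwards [Ioo_mem_nhds hz0 hz1] with t ht
    have h := G1.hasDerivAt_gps β ht
    exact h.congr_of_eventuallyEq (Filter.eventuallyEq_of_mem (Ioo_mem_nhds ht.1 ht.2) E1)
  have hd2 : HasDerivAt F1 (F2 z) z := (G1.mul_weight β).hasDerivAt_gps (β - 1) ⟨hz0, hz1⟩
  set H1 := gps (fun p : ℕ × ℕ => k p * (z ^ β * z ^ p.1) * (((p.2 : ℕ) : ℝ) + β)) Prod.snd (β - 1)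
    with hH1
  set H2 := gps (fun p : ℕ × ℕ => k p * (z ^ β * z ^ p.1) * (((p.2 : ℕ) : ℝ) + β) *
      (((p.2 : ℕ) : ℝ) + (β - 1))) Prod.snd (β - 1 - 1) with hH2
  have he1 : ∀ᶠ t in 𝓝 zb, HasDerivAt (fun s => g z s) (H1 t) t := by
    filter_upwards [Ioo_mem_nhds hzb0 hzb1] with t ht
    have h := G2.hasDerivAt_gps β ht
    exact h.congr_of_eventuallyEq (Filter.eventuallyEq_of_mem (Ioo_mem_nhds ht.1 ht.2) E2)
  have he2 : HasDerivAt H1 (H2 zb) zb := (G2.mul_weight β).hasDerivAt_gps (β - 1) ⟨hzb0, hzb1⟩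
  -- the two partial functions of the conjugated block, near the point
  have S1 : (fun t => conjBlock α g t zb) =ᶠ[𝓝 z]
      fun t => (1 - zb) ^ α * ((1 - t) ^ α * g t zb) := by
    filter_upwards [Ioo_mem_nhds hz0 hz1] with t ht
    rw [conjBlock_eq_of_lt α g ht.2 hzb1]; ring
  have S2 : (fun t => conjBlock α g z t) =ᶠ[𝓝 zb]
      fun t => (1 - z) ^ α * ((1 - t) ^ α * g z t) := by
    filter_upwards [Ioo_mem_nhds hzb0 hzb1] with t ht
    rw [conjBlock_eq_of_lt α g hz1 ht.2]; ring
  -- the second-order pieces: operator conjugation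
  have P1 : dolanOsbornD (-a) (-b) (fun t => conjBlock α g t zb) z =
      (1 - zb) ^ α * ((1 - z) ^ α * dolanOsbornD a b (fun t => g t zb) z) := by
    rw [dolanOsbornD_congr_of_eventuallyEq S1, dolanOsbornD_const_mul, hα,
      dolanOsbornD_conj a b hz1 hd1 hd2]
  have P2 : dolanOsbornD (-a) (-b) (fun t => conjBlock α g z t) zb =
      (1 - z) ^ α * ((1 - zb) ^ α * dolanOsbornD a b (fun t => g z t) zb) := by
    rw [dolanOsbornD_congr_of_eventuallyEq S2, dolanOsbornD_const_mul, hα,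
      dolanOsbornD_conj a b hzb1 he1 he2]
  -- the first-order pieces
  have P3 : deriv (fun t => conjBlock α g t zb) z =
      (1 - zb) ^ α * (-α * (1 - z) ^ (α - 1) * g z zb + (1 - z) ^ α * deriv (fun t => g t zb) z) := by
    rw [S1.deriv_eq, hd1.self_of_nhds.deriv]
    exact (((hasDerivAt_one_sub_rpow α hz1).mul hd1.self_of_nhds).const_mul ((1 - zb) ^ α)).deriv
  have P4 : deriv (fun t => conjBlock α g z t) zb =
      (1 - z) ^ α * (-α * (1 - zb) ^ (α - 1) * g z zb + (1 - zb) ^ α * deriv (fun t => g z t) zb) := by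
    rw [S2.deriv_eq, he1.self_of_nhds.deriv]
    exact (((hasDerivAt_one_sub_rpow α hzb1).mul he1.self_of_nhds).const_mul ((1 - z) ^ α)).deriv
  -- assemble
  have hCz := hC z zb ⟨hz0, hz1⟩ ⟨hzb0, hzb1⟩
  unfold CasimirEq3D at hCz ⊢
  have hpar1 : -(-Δ₁₂) / 2 = -a := by rw [ha]; ring
  have hpar2 : -Δ₃₄ / 2 = -b := by rw [hb]; ring
  rw [hpar1, hpar2, P1, P2, P3, P4, conjBlock_eq_of_lt α g hz1 hzb1]
  rw [← ha, ← hb] at hCz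
  have hw : (1 : ℝ) - z ≠ 0 := by linarith
  have hwb : (1 : ℝ) - zb ≠ 0 := by linarith
  have hu : (1 - z) ^ α = (1 - z) ^ (α - 1) * (1 - z) := by
    rw [← Real.rpow_add_one hw (α - 1), sub_add_cancel]
  have hub : (1 - zb) ^ α = (1 - zb) ^ (α - 1) * (1 - zb) := by
    rw [← Real.rpow_add_one hwb (α - 1), sub_add_cancel]
  rw [hu, hub]
  linear_combination ((1 - z) ^ (α - 1) * (1 - z) * ((1 - zb) ^ (α - 1) * (1 - zb))) * hCz

end Casimir

/-! ### Part E — the typed predicates -/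

/-- **Conjugation symmetry, generic predicate.** If `g` is `g^{Δ₁₂,Δ₃₄}_{Δ,ℓ}` in the sense of
`IsConformalBlock3DAbove`, then `v^{(Δ₃₄-Δ₁₂)/2} g` is `g^{-Δ₁₂,-Δ₃₄}_{Δ,ℓ}` in the same sense: the series
clause by `IsDoublePowerSeriesOn.conj`, symmetry and boundary row by `conjCoeff_symm` /
`hasLeadingPart_conjCoeff` (the normalisation `c_ℓ` is `(Δ₁₂, Δ₃₄)`-independent), the Casimir equation by
`casimirEq3D_conjBlock`. [cite: DolanOsborn2011, §2 eqs. (2.43)–(2.44)] -/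
theorem IsConformalBlock3DAbove.conj {Δ₁₂ Δ₃₄ Δ : ℝ} {ℓ : ℕ} {g : ℝ → ℝ → ℝ}
    (h : IsConformalBlock3DAbove Δ₁₂ Δ₃₄ Δ ℓ g) :
    IsConformalBlock3DAbove (-Δ₁₂) (-Δ₃₄) Δ ℓ (conjBlock ((Δ₃₄ - Δ₁₂) / 2) g) := by
  obtain ⟨k, K, hS, hsym, hlead, hg, hC⟩ := h
  refine ⟨conjCoeff ((Δ₃₄ - Δ₁₂) / 2) k,
    fun z zb => (1 - z) ^ ((Δ₃₄ - Δ₁₂) / 2) * (1 - zb) ^ ((Δ₃₄ - Δ₁₂) / 2) * K z zb,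
    hS.conj _, conjCoeff_symm _ hsym, hasLeadingPart_conjCoeff _ hlead, ?_, ?_⟩
  · intro z zb hz hzb
    rw [conjBlock_eq_of_lt _ g hz.2 hzb.2, hg z zb hz hzb]
    ring
  · intro z zb hz hzb
    exact casimirEq3D_conjBlock hS hg hC hz hzb

/-- **Conjugation symmetry of genuine 3D blocks** (Dolan–Osborn 2011 eq. (2.44) with the sign of (2.37)–(2.38),
for the typed predicate incl. the limit clause at non-regular points): if `g` is `g^{Δ₁₂,Δ₃₄}_{Δ,ℓ}` then
`((1-z)(1-z̄))^{(Δ₃₄-Δ₁₂)/2} · g` is `g^{-Δ₁₂,-Δ₃₄}_{Δ,ℓ}`. [cite: DolanOsborn2011, §2 eqs. (2.43)–(2.44)] -/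
theorem IsConformalBlock3D.conj {Δ₁₂ Δ₃₄ Δ : ℝ} {ℓ : ℕ} {g : ℝ → ℝ → ℝ}
    (h : IsConformalBlock3D Δ₁₂ Δ₃₄ Δ ℓ g) :
    IsConformalBlock3D (-Δ₁₂) (-Δ₃₄) Δ ℓ (conjBlock ((Δ₃₄ - Δ₁₂) / 2) g) := by
  rcases h with ⟨hreg, hA⟩ | ⟨hnreg, G, hG, hlim⟩
  · exact Or.inl ⟨hreg, hA.conj⟩
  · refine Or.inr ⟨hnreg, fun Δ' => conjBlock ((Δ₃₄ - Δ₁₂) / 2) (G Δ'), fun Δ' hΔ' => (hG Δ' hΔ').conj, ?_⟩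
    intro z zb hz hzb
    exact (hlim z zb hz hzb).const_mul _

/-- The same symmetry read in the other direction: conjugating a `(-Δ₁₂,-Δ₃₄)` block with the exponent
`(Δ₁₂-Δ₃₄)/2` gives a `(Δ₁₂,Δ₃₄)` block (apply `conj` and simplify the double negations).
[cite: DolanOsborn2011, §2 eq. (2.44)] -/
theorem IsConformalBlock3D.conj_neg {Δ₁₂ Δ₃₄ Δ : ℝ} {ℓ : ℕ} {g : ℝ → ℝ → ℝ}
    (h : IsConformalBlock3D (-Δ₁₂) (-Δ₃₄) Δ ℓ g) :
    IsConformalBlock3D Δ₁₂ Δ₃₄ Δ ℓ (conjBlock ((Δ₁₂ - Δ₃₄) / 2) g) := by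
  have h' := h.conj
  simp only [neg_neg] at h'
  have hexp : (-Δ₃₄ - -Δ₁₂) / 2 = (Δ₁₂ - Δ₃₄) / 2 := by ring
  rwa [hexp] at h'

/-- **Uniqueness form at regular points.** Above the unitarity bound and off the accidental degeneracies, ANY
typed `g₂ = g^{-Δ₁₂,-Δ₃₄}_{Δ,ℓ}` equals `v^{(Δ₃₄-Δ₁₂)/2} g₁` on the square for any typed
`g₁ = g^{Δ₁₂,Δ₃₄}_{Δ,ℓ}` (`IsConformalBlock3DAbove.eqOn_of_isRegular`). [cite: DolanOsborn2011, §2 eq. (2.44)] -/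
theorem IsConformalBlock3D.eq_conj_of_neg {Δ₁₂ Δ₃₄ Δ : ℝ} {ℓ : ℕ} {g₁ g₂ : ℝ → ℝ → ℝ}
    (hΔ : unitarityBound3D ℓ < Δ) (hreg : ¬ accidentalDegeneracy3D Δ ℓ)
    (h₁ : IsConformalBlock3D Δ₁₂ Δ₃₄ Δ ℓ g₁) (h₂ : IsConformalBlock3D (-Δ₁₂) (-Δ₃₄) Δ ℓ g₂)
    {z zb : ℝ} (hz : z ∈ Ioo (0 : ℝ) 1) (hzb : zb ∈ Ioo (0 : ℝ) 1) :
    g₂ z zb = ((1 - z) * (1 - zb)) ^ ((Δ₃₄ - Δ₁₂) / 2) * g₁ z zb := by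
  have hregpt : IsRegularPoint3D Δ ℓ := ⟨ne_of_gt hΔ, hreg⟩
  have hA₁ := (isConformalBlock3D_iff_above_of_isRegularPoint3D hregpt).mp h₁.conj
  have hA₂ := (isConformalBlock3D_iff_above_of_isRegularPoint3D hregpt).mp h₂
  exact IsConformalBlock3DAbove.eqOn_of_isRegular hΔ hreg hA₂ hA₁ z zb hz hzb

/-! ### The `σ–ε` system: the `⟨σεεσ⟩` block from the typed `gpm` -/

namespace SigmaEpsilonData

/-- **Under A2, `v^{Δ_σε} · gpm j` is the genuine `⟨σεεσ⟩`-ordering block `g^{Δ_σε,-Δ_σε}_{Δ,ℓ}` of the odd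
operator `j`** (`gpm j = g^{-Δ_σε,Δ_σε}`; exponent `(Δ₃₄-Δ₁₂)/2 = (Δ_σε - (-Δ_σε))/2 = Δ_σε`). So the second
reflection-positive ordering of the `σ × ε` OPE needs no data beyond the typed `gpm`.
[cite: DolanOsborn2011, §2 eq. (2.44)] -/
theorem isConformalBlock3D_conj_gpm (D : SigmaEpsilonData) (hA2 : D.HasGenuineBlocks) (j : D.ιm) :
    IsConformalBlock3D D.Δσε (-D.Δσε) (D.Δm j) (D.ℓm j) (conjBlock D.Δσε (D.gpm j)) := by
  have h := (hA2.2.2 j).conj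
  have hexp : (D.Δσε - -D.Δσε) / 2 = D.Δσε := by ring
  rw [neg_neg, hexp] at h
  exact h

/-- **The `⟨σεεσ⟩` block as a non-negative double series from the typed `gpm`.** At a regular `(Δ, ℓ)` and every
real point of the square, `v^{Δ_σε} gpm_j(x,y) = Σ_{(n,j')} (A_{n,j'}(-c,-c)/λ_ℓ) 𝒫_{Δ+n,j'}(x,y)`, `c = Δ_σε/2`
(`BlockZSeriesAB.IsConformalBlock3D.hasSum_hrZTermAB` for the conjugated block; all terms `≥ 0` by
`hrZTermAB_self_nonneg`). [cite: DolanOsborn2004, §3 eq. (3.11)] -/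
theorem hasSum_hrZTermAB_conj_gpm (D : SigmaEpsilonData) (hA2 : D.HasGenuineBlocks) (j : D.ιm)
    (hΔ : unitarityBound3D (D.ℓm j) < D.Δm j) (hreg : ¬ accidentalDegeneracy3D (D.Δm j) (D.ℓm j))
    {x y : ℝ} (hx : x ∈ Ioo (0 : ℝ) 1) (hy : y ∈ Ioo (0 : ℝ) 1) :
    HasSum (hrZTermAB (-D.Δσε / 2) (-D.Δσε / 2) (D.Δm j) (D.ℓm j) x y)
      (conjBlock D.Δσε (D.gpm j) x y) :=
  (D.isConformalBlock3D_conj_gpm hA2 j).hasSum_hrZTermAB hΔ hreg (by rw [neg_neg]) hx hy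

/-- Every finite partial sum of that series is a lower bound for `v^{Δ_σε} gpm_j(x,y)`.
[cite: DolanOsborn2004, §3 eq. (3.11)] -/
theorem sum_hrZTermAB_le_conj_gpm (D : SigmaEpsilonData) (hA2 : D.HasGenuineBlocks) (j : D.ιm)
    (hΔ : unitarityBound3D (D.ℓm j) < D.Δm j) (hreg : ¬ accidentalDegeneracy3D (D.Δm j) (D.ℓm j))
    {x y : ℝ} (hx : x ∈ Ioo (0 : ℝ) 1) (hy : y ∈ Ioo (0 : ℝ) 1) (F : Finset (ℕ × ℕ)) :
    ∑ q ∈ F, hrZTermAB (-D.Δσε / 2) (-D.Δσε / 2) (D.Δm j) (D.ℓm j) x y q ≤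
      ((1 - x) * (1 - y)) ^ D.Δσε * D.gpm j x y :=
  (D.isConformalBlock3D_conj_gpm hA2 j).sum_hrZTermAB_le hΔ hreg (by rw [neg_neg]) hx hy F

end SigmaEpsilonData

end Literature.MathematicalPhysics.QuantumFieldTheory.ConformalBootstrap3D
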